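import Summits.ResolutionOfSingularities.ResolutionOfSingularities.Theorems.EquisingularLiftEquisingularLiftNatTowerRoundTwoDefs
import Summits.ResolutionOfSingularities.ResolutionOfSingularities.Theorems.EquisingularLiftEquisingularLiftNatSubchainSupplierDriver
import HarnessLib

/-!
# [OURS · L1 W4.5(b) · EL♮(3)] HSUB′(ReachNoseTower₃) FROM ONE INVARIANT — the induction DRIVER for rung NOSE-TOWER₃
# (res-L1-w45b-lead-2's wording …NatTowerRoundTwoDefs p562650: `ReachNoseTower₃` = the closure of the nose seed under `TowerPtReg₂` / `TowerPtRam₂`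
# (…NatTowerReachTwoDefs p556233) and `TowerRound₂` (RULING-7); stub `stub_elnat_ratNoseTowerResolution` (names kept, text TARGET-RATNOSETOWER3
# 3a52d702128a1d15); twin of res-D-pv-029's tower drivers `hsub_reachTower₂_of_invariant` (…NatTowerDriverTwo p559837) / `₃`)

Crux `EquisingularLiftNat` = stmt-ResolutionOfSingularities-20038 (child EL♮(3) = stmt-ResolutionOfSingularities-20148), route
EquisingularLift, line `sections`. Helper file `--supports stmt-ResolutionOfSingularities-20148 --as helper` by res-D-pv-035 g8
(W4.5b NOSETOWER₃ ASSEMBLER: custody res-plan-2 IDLE POOL DEAL #58 (2) 2026-08-27T19:34:08Z, res-L1-w45b-plan-1 CONFIRM 19:35:13Z «binder list +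
`hsub_reachNoseTower₃_of_invariant` = twin of res-D-pv-029's driver over `ReachNoseTower₃`»). HONEST FRAMING: OURS (cell res-hironaka, slot W4.5(b));
NOT a statement of any manuscript; AI-written, weaker than expert review. No `sorry`; standard axioms. Pure logic — the pattern is res-D-pv-029's
`hsub_reachTower₂_of_invariant` (p559837) with the in-carrier half removed: THE NOSE BLOW-UP IS THE CARRIER-CURVE BLOW-UP.

WHAT. `hsub_reachNoseTower₃_of_invariant`: the BINDER LIST HSUB′(ReachNoseTower₃) — K5′'s sub-chain-supplier frame (res-D-pv-029
`target_elnat_of_subchainResolution'` p523491: the base `O ↠ k`, the ambient `P → Spec O` with the stage predicate `Ch` closed under horizontal E1 steps,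
a `Ch`-stage `(X', σ', S')` with its MODEL SQUARE `j : F₁ → X'` over `Spec θ` and `j '' T₁ = S'`) in which K5′'s POINT block (closed point `x`,
section `s`, T-DIM) is replaced by the NOSE block: a closed INFINITE `Z ⊊ T₁` (the nose curve), an `O`-SMOOTH centre `C ⊂ X'` (regular, `O`-flat)
with EXACT TRACE `C · 𝒪_{F₁} = 𝓘⟨Z⟩` off the generic point of `Y`, its blow-up `τ₁ : X₁ → X'` with the `Ch`-stage
`(X₁, τ₁ ≫ σ', j₂ '' closure υ⁻¹(T₁ ∖ Z))` (integral, locally Noetherian, regular, dominant), the downstairs blow-up `υ : F₂ → F₁` of `𝓘⟨Z⟩` with its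
model square `j₂ : F₂ → X₁`, `j₂ ≫ τ₁ = υ ≫ j`, and the exceptional identity `(C·𝒪_{X₁})·𝒪_{F₂} = 𝓘⟨Z⟩·𝒪_{F₂}` (res-type-100's `modelStep` p509016
delivers exactly these for ANY regular `O`-flat centre with a prescribed trace — so the closer `stub_elnat_ratNoseTowerResolution_of_subchainLift₃`,
asked of res-L1-w45b-lead-2, is «Witt ring + `ℙⁿ_O` + `lift_of_isLiftableNoseClass₂` (p538681) + `modelStep` + this supplier + K5′'s END transport»);
then — for every chain `(F', γ', T', E', K')` in the closure of the NOSE SEED `(F₂, 𝟙, closure υ⁻¹(T₁ ∖ Z), υ⁻¹Z, ∅)` under `TowerPtReg₂ F₁ F₂ υ`,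
`TowerPtRam₂ F₁ F₂ υ`, `TowerRound₂ F₁ F₂ υ Z hZ` (VERBATIM the inner clause of `ReachNoseTower₃` with `ℙⁿ_k ↦ F₁`, `range ι ↦ T₁`) — the
`Ch`-stage with a model square realising `(F', T')` (K5′'s conclusion VERBATIM). Inserted before the last quantifier block: ONE invariant
`INV₁ F₉ Z₉ hZ₉ F₁₀ υ' G γ T E K` of the SAME TYPE as the tower driver's (so that `INV₁ := Tower.Inv₂ O k θ P q Y Ch Ruled` (…NatTowerInvDefs p556392)
and every context-free tower brick — (pt-reg) `Tower.towerPtReg₂_inv₂` p562007, (pt-ram) res-L1-w45b-stub-4 `Tower.towerPtRam₂_inv₂` p560137, (round)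
res-D-pv-029's `hsub_reachTower_three_of` stand-ins / bricks, (final) `Tower.inv₂_final` — plugs in BY NAME) with FIVE hypotheses:
  (seed)   `INV₁ F₁ Z hZ F₂ υ` on the nose seed — the ONE new brick of the nose assembly (the nose analogue of 029's curve step
           `Tower.inv₂_of_invKC_curveStep` p558664: `𝓔 := C·𝒪_{X₁}`, exact reduced trace because `Z` is regular, `DirLift.Ruled` born at the root
           `(X', C)` by res-L1-w45b-stub-2's `DirLift.ruled_root`, shadow `∅`);
  (pt-reg) / (pt-ram) / (round) closure of `INV₁ F₉ Z₉ hZ₉ F₁₀ υ'` under `TowerPtReg₂` / `TowerPtRam₂` / `TowerRound₂` for EVERY carrier context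
           (VERBATIM the tower driver's clauses; the nose uses them at `(F₁, Z, F₂, υ)`);
  (final)  VERBATIM the tower driver's clause.
PROOF: run the closure hypothesis of the chain at `R₁ := INV₁ F₁ Z hZ F₂ υ`, finish with (final). The statement is ∀ `n` (as K5′); the assembly
specialises `n = 3` (T-DIRLIFT's 2-frames), as res-D-pv-029's `hsub_reachTower_three_of` does.

References: res-D-pv-029 …NatTowerDriverTwo (p559837), K5′ …NatSubchainPointResolutionOff (p523491), …NatTowerInvDefs (p556392); res-L1-w45b-lead-2
…NatTowerRoundTwoDefs (p562650), …NatTowerReachTwoDefs (p556233), LEAD-MEMO-8 §2 / LEAD-MEMO-9 §1; res-type-100 …NatModelStep (p509016) (OURS, index only).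
-/

set_option linter.dupNamespace false -- mandated namespace `Summit.<Summit>.<Problem>` of this single-conjunct summit
set_option linter.overlappingInstances false -- signatures carry `[IsDomain O] [IsDiscreteValuationRing O]`

noncomputable section

open CategoryTheory CategoryTheory.Limits AlgebraicGeometry TopologicalSpace Topology
open Literature.AlgebraicGeometry.Resolution
open AlgebraicGeometry.Scheme.IdealSheafData

namespace Summit.ResolutionOfSingularities.ResolutionOfSingularities.Cruxes.EquisingularLiftNat.Sections

/-- **HSUB′(ReachNoseTower₃) from one invariant of the tower** (the induction driver of rung NOSE-TOWER₃; see the module docstring for the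
binder list). [folklore; pure logic over res-D-pv-029's K5′ binders and res-L1-w45b-lead-2's tower predicates] [OURS · L1 W4.5b] toward
`stub_elnat_ratNoseTowerResolution` (stmt-ResolutionOfSingularities-20148 / -20038); NOT a statement of the manuscript. -/
theorem hsub_reachNoseTower₃_of_invariant (k : Type) [Field k] (n : ℕ) :
    ∀ (O : Type) [CommRing O] [IsDomain O] [IsDiscreteValuationRing O] [IsAdicComplete (IsLocalRing.maximalIdeal O) O] [IsAlgClosed (IsLocalRing.ResidueField O)] (θ : O →+* k), Function.Surjective θ → ∀ (P : AlgebraicGeometry.Scheme.{0}) (q : P ⟶ AlgebraicGeometry.Spec (.of O)) (Y : Set P) (Ch : ∀ X' : AlgebraicGeometry.Scheme.{0}, (X' ⟶ P) → Set X' → Prop), (∀ (X' X'' : AlgebraicGeometry.Scheme.{0}) (σ' : X' ⟶ P) (S' : Set X') (C : X'.IdealSheafData) (τ : X'' ⟶ X'), Ch X' σ' S' → Literature.AlgebraicGeometry.Resolution.IsBlowup τ C → Literature.AlgebraicGeometry.Resolution.Scheme.IsRegular C.subscheme → AlgebraicGeometry.Flat (C.subschemeι ≫ σ' ≫ q) →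 σ' '' (C.support : Set X') ⊆ {y | ¬ IsGenericPoint y Y} → (C.support : Set X') ∩ (σ' ≫ q) ⁻¹' {IsLocalRing.closedPoint O} ⊆ S' → Ch X'' (τ ≫ σ') (closure (τ ⁻¹' (S' \ (C.support : Set X'))))) → (∀ (X' : AlgebraicGeometry.Scheme.{0}) (σ' : X' ⟶ P) (S' : Set X'), Ch X' σ' S' → Summit.ResolutionOfSingularities.ResolutionOfSingularities.Theses.EquisingularLift.Split.Chain P Y X' σ' S') → Y ⊆ q ⁻¹' {IsLocalRing.closedPoint O} → IsIrreducible Y → IsClosed Y → AlgebraicGeometry.IsIntegral P → IsLocallyNoetherian P → Literature.AlgebraicGeometry.Resolution.Scheme.IsRegular P → AlgebraicGeometry.IsProper q → AlgebraicGeometry.SmoothOfRelativeDimension n q → ∀ (X' : AlgebraicGeometry.Scheme.{0}) (σ' : X' ⟶ P) (S' : Set X'), Ch X' σ' S' → AlgebraicGeometry.IsIntegral X' → IsLocallyNoetherian X' → Literature.AlgebraicGeometry.Resolution.Scheme.IsRegular X' → AlgebraicGeometry.IsDominant (σ' ≫ q) → ∀ (F₁ : AlgebraicGeometry.Scheme.{0}),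 AlgebraicGeometry.IsIntegral F₁ → ∀ (j : F₁ ⟶ X') (t : F₁ ⟶ AlgebraicGeometry.Spec (.of k)), IsPullback j t (σ' ≫ q) (AlgebraicGeometry.Spec.map (CommRingCat.ofHom θ)) → ∀ (T₁ : Set F₁), IsClosed T₁ → IsIrreducible T₁ → j '' T₁ = S' → ∀ (Z : Set F₁) (hZ : IsClosed Z), Z ⊆ T₁ → ¬ (T₁ ⊆ Z) → Z.Infinite → ∀ (C : X'.IdealSheafData), AlgebraicGeometry.Smooth (C.subschemeι ≫ σ' ≫ q) → Literature.AlgebraicGeometry.Resolution.Scheme.IsRegular C.subscheme → AlgebraicGeometry.Flat (C.subschemeι ≫ σ' ≫ q) → C.comap j = AlgebraicGeometry.Scheme.IdealSheafData.vanishingIdeal (⟨Z, hZ⟩ : TopologicalSpace.Closeds F₁) → (∀ c ∈ (C.support : Set X'), ¬ IsGenericPoint (σ' c) Y) → ∀ (X₁ : AlgebraicGeometry.Scheme.{0}) (τ₁ : X₁ ⟶ X'), Literature.AlgebraicGeometry.Resolution.IsBlowup τ₁ C → AlgebraicGeometry.IsIntegral X₁ → IsLocallyNoetherian X₁ → Literature.AlgebraicGeometry.Resolution.Scheme.IsRegular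 X₁ → AlgebraicGeometry.IsDominant ((τ₁ ≫ σ') ≫ q) → ∀ (F₂ : AlgebraicGeometry.Scheme.{0}), AlgebraicGeometry.IsIntegral F₂ → ∀ (υ : F₂ ⟶ F₁), Literature.AlgebraicGeometry.Resolution.IsBlowup υ (AlgebraicGeometry.Scheme.IdealSheafData.vanishingIdeal (⟨Z, hZ⟩ : TopologicalSpace.Closeds F₁)) → ∀ (j₂ : F₂ ⟶ X₁) (t₂ : F₂ ⟶ AlgebraicGeometry.Spec (.of k)), IsPullback j₂ t₂ ((τ₁ ≫ σ') ≫ q) (AlgebraicGeometry.Spec.map (CommRingCat.ofHom θ)) → j₂ ≫ τ₁ = υ ≫ j → (C.comap τ₁).comap j₂ = (AlgebraicGeometry.Scheme.IdealSheafData.vanishingIdeal (⟨Z, hZ⟩ : TopologicalSpace.Closeds F₁)).comap υ → IsIrreducible (closure (υ ⁻¹' (T₁ \ Z))) → Ch X₁ (τ₁ ≫ σ') (j₂ '' closure (υ ⁻¹' (T₁ \ Z))) → ∀ (INV₁ : ∀ (F₉ : AlgebraicGeometry.Scheme.{0}) (Z₉ : Set F₉), IsClosed Z₉ → ∀ (F₁₀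 : AlgebraicGeometry.Scheme.{0}), (F₁₀ ⟶ F₉) → ∀ G : AlgebraicGeometry.Scheme.{0}, (G ⟶ F₁₀) → Set G → Set G → Set G → Prop),
      -- (seed) the tower invariant on the nose seed `(F₂, 𝟙, closure υ⁻¹(T₁ ∖ Z), υ⁻¹ Z, ∅)` (the nose blow-up IS the carrier-curve blow-up: `F₉ := F₁`, `Z₉ := Z`, `F₁₀ := F₂`, `υ' := υ`)
      INV₁ F₁ Z hZ F₂ υ F₂ (𝟙 F₂) (closure (υ ⁻¹' (T₁ \ Z))) (υ ⁻¹' Z) ∅ →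
      -- (pt-reg) the tower invariant is closed under `TowerPtReg₂` (VERBATIM the tower driver's clause, context-free)
      (∀ (F₉ : AlgebraicGeometry.Scheme.{0}) (Z₉ : Set F₉) (hZ₉ : IsClosed Z₉) (F₁₀ : AlgebraicGeometry.Scheme.{0}) (υ' : F₁₀ ⟶ F₉), TowerPtReg₂ F₉ F₁₀ υ' (INV₁ F₉ Z₉ hZ₉ F₁₀ υ')) →
      -- (pt-ram) … under `TowerPtRam₂`
      (∀ (F₉ : AlgebraicGeometry.Scheme.{0}) (Z₉ : Set F₉) (hZ₉ : IsClosed Z₉) (F₁₀ : AlgebraicGeometry.Scheme.{0}) (υ' : F₁₀ ⟶ F₉), TowerPtRam₂ F₉ F₁₀ υ' (INV₁ F₉ Z₉ hZ₉ F₁₀ υ')) →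
      -- (round) … under `TowerRound₂` (RULING-7: Čech rounds along SECTIONS over a rational carrier, or cone-witnessed — the latter never fires from the seed shadow `∅`)
      (∀ (F₉ : AlgebraicGeometry.Scheme.{0}) (Z₉ : Set F₉) (hZ₉ : IsClosed Z₉) (F₁₀ : AlgebraicGeometry.Scheme.{0}) (υ' : F₁₀ ⟶ F₉), TowerRound₂ F₉ F₁₀ υ' Z₉ hZ₉ (INV₁ F₉ Z₉ hZ₉ F₁₀ υ')) →
      -- (final) the tower invariant yields the `Ch`-stage with a model square that the closer asks for (VERBATIM the tower driver's clause)
      (∀ (F₉ : AlgebraicGeometry.Scheme.{0}) (Z₉ : Set F₉) (hZ₉ : IsClosed Z₉) (F₁₀ : AlgebraicGeometry.Scheme.{0}) (υ' : F₁₀ ⟶ F₉) (G : AlgebraicGeometry.Scheme.{0}) (γ : G ⟶ F₁₀) (T E K : Set G), INV₁ F₉ Z₉ hZ₉ F₁₀ υ' G γ T E K → ∃ (X₉ : AlgebraicGeometry.Scheme.{0}) (σ₉ : X₉ ⟶ P) (S₉ : Set X₉) (j₉ : G ⟶ X₉) (t₉ : G ⟶ AlgebraicGeometry.Spec (.of k)),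 Ch X₉ σ₉ S₉ ∧ AlgebraicGeometry.IsIntegral X₉ ∧ IsLocallyNoetherian X₉ ∧ Literature.AlgebraicGeometry.Resolution.Scheme.IsRegular X₉ ∧ AlgebraicGeometry.IsDominant (σ₉ ≫ q) ∧ IsPullback j₉ t₉ (σ₉ ≫ q) (AlgebraicGeometry.Spec.map (CommRingCat.ofHom θ)) ∧ j₉ '' T = S₉ ∧ IsClosed T ∧ IsIrreducible T ∧ AlgebraicGeometry.IsIntegral G) →
      ∀ (F' : AlgebraicGeometry.Scheme.{0}) (γ' : F' ⟶ F₂) (T' E' K' : Set F'), (∀ R₁ : (∀ G : AlgebraicGeometry.Scheme.{0}, (G ⟶ F₂) → Set G → Set G → Set G → Prop), R₁ F₂ (𝟙 F₂) (closure (υ ⁻¹' (T₁ \ Z))) (υ ⁻¹' Z) ∅ → TowerPtReg₂ F₁ F₂ υ R₁ → TowerPtRam₂ F₁ F₂ υ R₁ → TowerRound₂ F₁ F₂ υ Z hZ R₁ → R₁ F' γ' T' E' K') → ∃ (X₉ : AlgebraicGeometry.Scheme.{0}) (σ₉ : X₉ ⟶ P) (S₉ : Set X₉) (j₉ : F' ⟶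 X₉) (t₉ : F' ⟶ AlgebraicGeometry.Spec (.of k)), Ch X₉ σ₉ S₉ ∧ AlgebraicGeometry.IsIntegral X₉ ∧ IsLocallyNoetherian X₉ ∧ Literature.AlgebraicGeometry.Resolution.Scheme.IsRegular X₉ ∧ AlgebraicGeometry.IsDominant (σ₉ ≫ q) ∧ IsPullback j₉ t₉ (σ₉ ≫ q) (AlgebraicGeometry.Spec.map (CommRingCat.ofHom θ)) ∧ j₉ '' T' = S₉ ∧ IsClosed T' ∧ IsIrreducible T' ∧ AlgebraicGeometry.IsIntegral F' := by
  intro O _ _ _ _ _ θ hθ P q Y Ch hChStep hChSplit hYsp hYirr hYcl hPint hPnoeth hPreg hqprop hqsm X' σ' S' hCh' hX'int hX'noeth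
    hX'reg hX'dom F₁ hF₁ j t hsq T₁ hT₁cl hT₁irr hjT₁ Z hZ hZT₁ hT₁Z hZinf C hCsm hCreg hCfl hCj hCoff X₁ τ₁ hτ₁ hX₁int hX₁noeth
    hX₁reg hX₁dom F₂ hF₂ υ hυ j₂ t₂ hsq₂ hcomm hexc hirr₂ hCh₁ INV₁ hseed hptreg hptram hround hfinal F' γ' T' E' K' hcl
  -- the tower closure at `R₁ := INV₁ F₁ Z hZ F₂ υ`
  have h' : INV₁ F₁ Z hZ F₂ υ F' γ' T' E' K' :=
    hcl (INV₁ F₁ Z hZ F₂ υ) hseed (hptreg F₁ Z hZ F₂ υ) (hptram F₁ Z hZ F₂ υ) (hround F₁ Z hZ F₂ υ)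
  exact hfinal F₁ Z hZ F₂ υ F' γ' T' E' K' h'

end Summit.ResolutionOfSingularities.ResolutionOfSingularities.Cruxes.EquisingularLiftNat.Sections

end
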